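import Mathlib
import HarnessLib
import Summits.AtomisticToContinuum.HydrodynamicLimit.Theses.OneFlightGossipEngine
import Literature.Analysis.UnboundedOperators.LinearizedBoltzmann

/-!
# Sketch — crux-ideate stmt-AtomisticToContinuum-14662 (KineticCurrentsWindowLDUniform), round 1, ideator 3

First lemmas of the three idea cards (statements only; they must elaborate, not be proved):

* card `frozen-norm-gaussian-chaos`: `GaussianQuadraticPressure` (Hanson–Wright in variance form for a
  traceless quadratic form of a standard Gaussian vector, operator norm frozen) and its dynamical corollary
  `ExogenousSkeletonStressPressure` (the LD upgrade of the route's `GossipStressIdentity`: for EVERY exogenous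
  collision skeleton — schedule + linear isometries acting on relative velocities, which is the exact d = 3
  hard-sphere collision law given the contact normal — the Gaussian pressure of the window-averaged traceless
  stress is bounded by β² × its variance for |β| ≤ 1/4, uniformly in the length of the schedule).
* card `chessboard-corridor-transfer`: `SpeedCapFractionLD` (static, Gaussian-rate LD bound for the fraction
  of fast particles under a local Gibbs law — the price of the speed cap that makes influence cones
  deterministic).
* card `energy-pinned-corrector-telescoping`: `EnergyPinnedBoundary` (the corrector boundary term is bounded
  pathwise by the INITIAL kinetic energy, for correctors of quadratic growth, along any hard-sphere flow) and
  `ChapmanEnskogInverseLinearGrowth` (Fredholm inverse of the linearised hard-sphere operator on sources of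
  quadratic growth, with one power gained from ν(v) ≍ 1 + |v|).
-/

namespace Summit.AtomisticToContinuum.HydrodynamicLimit.Cruxes.KineticCurrentsWindowLDUniform.IdeatorThreeSketch

open scoped BigOperators Matrix
open MeasureTheory ProbabilityTheory
open Literature.MathematicalPhysics.KineticTheory (T3 V3)

noncomputable section

/-! ## Card 1 — frozen-norm Gaussian chaos -/

/-- **Hanson–Wright, variance form, frozen operator norm.** For a symmetric traceless `d × d` matrix `Q`
with `|xᵀQx| ≤ a|x|²` and the standard Gaussian `γ = ⊗ N(0,1)` on `ℝᵈ`: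
`∫ exp(β xᵀQx) dγ ≤ exp(2β²‖Q‖²_HS/(1 − 4|β|a))` whenever `4|β|a < 1`.
(Diagonalise; `E e^{βxᵀQx} = ∏(1 − 2βλ_j)^{-1/2}`; `−½log(1−u) − u/2 ≤ u²/(4(1−|u|))`; `Σλ_j = 0`.)
The point for the crux: the admissible range of `β` depends on the OPERATOR norm `a` only, the bound on the
HILBERT–SCHMIDT norm only. [Rudelson–Vershynin 2013, doi:10.1214/ecp.v18-2865, Thm 1.1; folklore for Gaussians] -/
def GaussianQuadraticPressure : Prop :=
  ∀ (d : ℕ) (Q : Matrix (Fin d) (Fin d) ℝ), Q.IsSymm → Q.trace = 0 →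
    ∀ a : ℝ, 0 ≤ a → (∀ x : Fin d → ℝ, |x ⬝ᵥ Q.mulVec x| ≤ a * (x ⬝ᵥ x)) →
      ∀ β : ℝ, 4 * |β| * a < 1 →
        ∫ x, Real.exp (β * (x ⬝ᵥ Q.mulVec x)) ∂(Measure.pi fun _ : Fin d => gaussianReal 0 1)
          ≤ Real.exp (2 * β ^ 2 * (∑ i, ∑ j, Q i j ^ 2) / (1 - 4 * |β| * a))

/-- One step of an EXOGENOUS hard-sphere skeleton on `n` velocities: the pair `(i, j)` is replaced by
`(V + ½ R g, V − ½ R g)`, `V = ½(cᵢ + cⱼ)`, `g = cᵢ − cⱼ`, `R` a linear isometry of `ℝ³`.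
For `R = ` the reflection across the contact normal this IS the elastic hard-sphere collision; in `d = 3`,
uniform impact parameter makes `R g` uniform on the sphere of radius `|g|`, i.e. equal in law to `O g` with `O`
Haar on `SO(3)` — so every fair-kick idealisation of the gas is a product of such LINEAR isometric steps. -/
def skeletonStep {n : ℕ} (p : Fin n × Fin n) (R : V3 ≃ₗᵢ[ℝ] V3) (c : Fin n → V3) : Fin n → V3 :=
  fun k =>
    if k = p.1 then (1 / 2 : ℝ) • (c p.1 + c p.2) + (1 / 2 : ℝ) • R (c p.1 - c p.2)
    else if k = p.2 then (1 / 2 : ℝ) • (c p.1 + c p.2) - (1 / 2 : ℝ) • R (c p.1 - c p.2)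
    else c k

/-- The velocity configuration after the first `t` steps of the skeleton `(s, R)`. -/
def skeletonState {n m : ℕ} (s : Fin m → Fin n × Fin n) (R : Fin m → (V3 ≃ₗᵢ[ℝ] V3))
    (t : ℕ) (c : Fin n → V3) : Fin n → V3 :=
  ((List.finRange m).take t).foldl (fun c u => skeletonStep (s u) (R u) c) c

/-- The skeleton-time average of the total traceless (shear-type) stress along direction `e`:
`(m+1)⁻¹ Σ_{t=0}^{m} Σ_k (⟪c_k^{(t)}, e⟫² − |c_k^{(t)}|²|e|²/3)`. -/
def stressAvg {n m : ℕ} (s : Fin m → Fin n × Fin n) (R : Fin m → (V3 ≃ₗᵢ[ℝ] V3)) (e : V3)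
    (c : Fin n → V3) : ℝ :=
  ((m : ℝ) + 1)⁻¹ * ∑ t : Fin (m + 1), ∑ k : Fin n,
    ((inner ℝ (skeletonState s R t c k) e) ^ 2 - ‖skeletonState s R t c k‖ ^ 2 * ‖e‖ ^ 2 / 3)

/-- **Exogenous-skeleton stress pressure (LD upgrade of `GossipStressIdentity`).** For EVERY schedule `s`
(pairs `iₜ ≠ jₜ`) and EVERY sequence of linear isometries `R`, every unit `e` and `|β| ≤ 1/4`:
`∫ exp(β · stressAvg) dγ^{⊗n} ≤ exp(β² ∫ stressAvg² dγ^{⊗n})`, `γ = stdGaussian V3`.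
Proof route: `c ↦ skeletonState s R t c` is a linear isometry of `(Fin n → V3)`, so `stressAvg` is a traceless
quadratic form `cᵀ𝒬c` with `‖𝒬‖_op ≤ 2/3` (a convex combination of isometric conjugates of the one-particle
form, eigenvalues `2/3, −1/3, −1/3`) and `‖𝒬‖²_HS = ½ Var_γ(stressAvg) = ½ ∫ stressAvg²`; apply
`GaussianQuadraticPressure`. No randomness of the skeleton, no length `m`, no `n` enters: ALL cumulants are
slaved to the second one. -/
def ExogenousSkeletonStressPressure : Prop :=
  ∀ (n m : ℕ) (s : Fin m → Fin n × Fin n), (∀ t, (s t).1 ≠ (s t).2) →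
    ∀ (R : Fin m → (V3 ≃ₗᵢ[ℝ] V3)) (e : V3), ‖e‖ = 1 →
      ∀ β : ℝ, |β| ≤ 1 / 4 →
        ∫ c, Real.exp (β * stressAvg s R e c) ∂(Measure.pi fun _ : Fin n => stdGaussian V3)
          ≤ Real.exp (β ^ 2 * ∫ c, (stressAvg s R e c) ^ 2 ∂(Measure.pi fun _ : Fin n => stdGaussian V3))

/-! ## Card 2 — chessboard corridor transfer -/

/-- **Speed-cap fraction LD (static, Gaussian rate).** Under a local Gibbs law with `θ₀ ≤ Θ` and `|u₀| ≤ U`,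
the configurations in which at least a fraction `δ` of the particles is faster than `V ≥ U` have probability
`≤ exp(−(N+1)(δ(V−U)²/(4Θ) − 2 log 2))`: velocities are conditionally independent Maxwellians given the
positions (the hard-core indicator and the normalisation see positions only), `P(|v − u₀| > V − U) ≤ 2e^{−(V−U)²/(4Θ)}`
in `ℝ³`, union over subsets. The rate `δ(V−U)²/(4Θ)` is UNBOUNDED in `V`: this is what lets the cap be
imposed at every fixed `β` (the bad event must beat `e^{Cβ²N}`), unlike collision-count or influence-chain
events. Junk-safe: if the partition function vanishes the law is `0`. -/
def SpeedCapFractionLD : Prop :=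
  ∀ (σ Θ U : ℝ) (a θ₀ : T3 → ℝ) (u₀ : T3 → V3), 0 < Θ → (∀ x, 0 < θ₀ x) → (∀ x, θ₀ x ≤ Θ) →
    (∀ x, ‖u₀ x‖ ≤ U) → ∀ (N : ℕ)
      (Φ : Literature.Analysis.FluidPDE.HardSphereFlow (Literature.Analysis.FluidPDE.Torus.geometry (Fin 3))
        (Literature.MathematicalPhysics.KineticTheory.hsDiameter σ N) (N + 1)),
      ∀ δ : ℝ, 0 < δ → δ ≤ 1 → ∀ V : ℝ, U ≤ V →
        Literature.MathematicalPhysics.KineticTheory.localGibbsLaw σ a u₀ θ₀ N Φ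
            {z | δ * ((N : ℝ) + 1) ≤ ((Finset.univ.filter fun i : Fin (N + 1) => V < ‖(z i).2‖).card : ℝ)}
          ≤ ENNReal.ofReal (Real.exp (-(((N : ℝ) + 1) * (δ * (V - U) ^ 2 / (4 * Θ) - 2 * Real.log 2))))

/-! ## Card 3 — energy-pinned corrector telescoping -/

/-- **Energy pins the corrector boundary term.** For a one-body corrector `ψ` of quadratic growth,
`|Σ_i ψ(z_i(t))| ≤ C((N : ℝ) + 2·configEnergy(z(t))) = C(N + 2·configEnergy(z(0)))` along every good orbit
of every hard-sphere flow (energy conservation, `IsHardSphereTrajectory.configEnergy_eq`). Consequence: the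
exponential moment of the boundary term `w⁻¹(Ψ(z(w)) − Ψ(z(0)))` is priced by the INITIAL Gaussian velocities
whatever the (non-invariant, local Gibbs) initial law — the only place where the law at time `w` would enter the
corrector identity at exponential scale is closed by a conservation law. -/
def EnergyPinnedBoundary : Prop :=
  ∀ {d : Type} [Fintype d] {X : Type} [MeasureSpace X] [TopologicalSpace X]
    (G : Literature.Analysis.FluidPDE.Geometry d X) (ε : ℝ) (N : ℕ)
    (Φ : Literature.Analysis.FluidPDE.HardSphereFlow G ε N) (ψ : X × EuclideanSpace ℝ d → ℝ) (C : ℝ),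
    (∀ y, |ψ y| ≤ C * (1 + ‖y.2‖ ^ 2)) →
      ∀ z ∈ Φ.good, ∀ t : ℝ,
        |∑ i, ψ (Φ.flow t z i)| ≤ C * ((N : ℝ) + 2 * Literature.Analysis.FluidPDE.configEnergy z)

/-- **Chapman–Enskog inverse with one power gained.** For a continuous source `g` of quadratic growth,
`M`-orthogonal to the collision invariants, the linearised hard-sphere operator has a continuous pre-image of
LINEAR growth: `L ψ = g`, `|ψ(v)| ≤ C₀K(1 + |v|)` (hard spheres: `ν(v) ≍ 1 + |v|`, `L = −ν + K`, Grad's splitting;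
the borderline-weight analysis recorded for bounded `g` in Cruxes/KineticFluxLdDecay/NegativeNotes-stub_chapmanEnskogInverse.md
applies verbatim one power up). This is what makes the corrector of the crux's `F` (traceless stress, radial-odd
functionals) an observable of growth `1 + |v| ≤ 2 + |v|²`, i.e. inside `EnergyPinnedBoundary`. [CIP1994 §7.2; Grad1963] -/
def ChapmanEnskogInverseLinearGrowth : Prop :=
  ∃ C₀ : ℝ, 0 < C₀ ∧ ∀ (g : V3 → ℝ) (K : ℝ), Continuous g → (∀ v, |g v| ≤ K * (1 + ‖v‖ ^ 2)) →
    (∀ φ ∈ Literature.Analysis.UnboundedOperators.collisionInvariants V3,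
        Literature.Analysis.UnboundedOperators.maxwellianInner g φ = 0) →
      ∃ ψ : V3 → ℝ, Continuous ψ ∧ (∀ v, |ψ v| ≤ C₀ * K * (1 + ‖v‖)) ∧
        (∀ φ ∈ Literature.Analysis.UnboundedOperators.collisionInvariants V3,
          Literature.Analysis.UnboundedOperators.maxwellianInner ψ φ = 0) ∧
        Literature.Analysis.UnboundedOperators.hardSphereLinearizedOp ψ = g

end

end Summit.AtomisticToContinuum.HydrodynamicLimit.Cruxes.KineticCurrentsWindowLDUniform.IdeatorThreeSketch
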